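import Literature.NumberTheory.EllipticCurves.BSDSelmerParityDokchitserDihedralProofs
import Literature.NumberTheory.EllipticCurves.ZpCorankDihedralAction
import Literature.NumberTheory.EllipticCurves.QuadraticTwistSelmerPInfty
import Literature.NumberTheory.EllipticCurves.ModifiedTamagawaProduct
import HarnessLib

/-!
# Step (4) of Dokchitser–Dokchitser's Thm. 4.19 from Prop. 4.17 **as printed**: the `D_{2p}` bookkeeping of p. 26

Proofs companion (theorems and auxiliary constructions with bodies; no named facts, D-0026) of
`BSDSelmerParityDokchitserProofs` for the named fact
`Literature.NumberTheory.EllipticCurves.dokchitser_selmerCorank_baseChange_mod_two_eq`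
("`rk_p(E/M₀)` is odd": T. Dokchitser, V. Dokchitser, *On the Birch–Swinnerton-Dyer quotients
modulo squares*, Ann. of Math. 172 (2010), §4.6, step (4) of the proof of Thm. 4.19 = Thm. 1.4).

The file `BSDSelmerParityDokchitserDihedralProofs` derives the named fact from the Cornut–Vatsal /
Nekovář input `hCV` and from Prop. 4.17 of the source *in the form in which it is invoked on
p. 27*, "`rk_p(E/M) + m_ρ ≡ ord_p C(E/F)/C(E/M) (mod 2)`", with `m_ρ` characterised by
`rk_p(E/F) = rk_p(E/M) + (p - 1) m_ρ` (hypothesis `h417D` there). Prop. 4.17 itself (p. 25) reads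

> "Suppose `Gal(F/K) = D_{2p}` with `p` an odd prime, and pick extensions `M/K` and `L/K` in `F`
> of degree `2` and `p`, respectively. For every principally polarised abelian variety `A/K`,
> `rk_p(A/M) + 2/(p-1) (rk_p(A/L) - rk_p(A/K)) ≡ ord_p C(A/F)/C(A/M) (mod 2)`."

and the passage from this to the p. 27 display is the representation-theoretic bookkeeping printed
on pp. 26–27:

> "`H = Gal(F/K) ≅ D_{2p}`. It has three `ℚ_p`-irreducible `p`-adic representations: trivial `1`,
> sign `ε` and `(p-1)`-dimensional `ρ`. … decompose `X = X_p(E/F) ≅ 1^{⊕m_1} ⊕ ε^{⊕m_ε} ⊕ ρ^{⊕m_ρ}`.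
> As `X_p(E/K) = X^H` etc. (Lemma 4.14), `rk_p(E/K) = m_1`, `rk_p(E/M) = m_1 + m_ε`,
> `rk_p(E/L) = m_1 + (p-1)/2 m_ρ`."

This file PROVES that bookkeeping for an elliptic curve over an arbitrary number field `R` (the
source's `K`) and an arbitrary `D_{2p}`-extension `F/R` (`exists_selmerCorank_dihedral_display`:
natural numbers `m_1, m_ε, m_ρ` with `rk_p(E/R) = m_1`, `rk_p(E/M) = m_1 + m_ε`,
`rk_p(E/L) = m_1 + (p-1)/2 m_ρ`, `rk_p(E/F) = m_1 + m_ε + (p-1) m_ρ`, for any quadratic `M/R`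
and any degree-`p` `L/R` inside `F`), and thereby derives the named fact from **Prop. 4.17
verbatim** (for elliptic curves; hypothesis `h417V`, in which the rational number
`2/(p-1)(rk_p(A/L) - rk_p(A/K))` — an integer, by the above — is transcribed with integer division)
together with `hCV` (`dokchitser_selmerCorank_baseChange_mod_two_eq_of_prop417_verbatim_of_hCV`,
through `prop417_p27_of_prop417_verbatim` and the assembly of
`BSDSelmerParityDokchitserDihedralProofs`).

## The proof of the bookkeeping (Lemma 4.14 for the three subgroups of `D_{2p}`)

Write `A = Sel_{p^∞}(E_F/F) ⊆ H¹(F, E_F[p^∞])` (the tree's `selmerGroupPInfty (E.baseChange F) p`),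
acted upon by `G = Aut(F/R)` through `σ_* = (isLiftOfAut_liftAut σ).relConjH1Primary E p`
(`autAct`; file `SelmerPInftyRelGaloisAction`), which preserves `A` for `p` odd
(`relConjH1Primary_mem_selmerGroupPInfty`) and is multiplicative in `σ` (`autAct_mul`,
`autAct_one`: in the subgroup model `σ_*` is conjugation by the transported lift `c_σ ∈ Γ_R`,
`RelModel.modelIso_relConjH1Primary`, and `c_{σσ'} ≡ c_σ c_{σ'}` modulo `galRange F`, which acts
trivially, `liftToAbsGal_mul_inv_mul_mem_galRange`).

* **Lemma 4.14, intrinsic field-level form** (`selmerCorank_eq_zpCorank_selmerAutInvariants`): for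
  `F/k` finite Galois, `rk_p(E/k) = corank_{ℤ_p} A^{Aut(F/k)}`, the invariants `A^{Aut(F/k)}`
  (`selmerAutInvariants`) being taken for `σ_*`; this is the tree's Lemma 4.14 in the subgroup
  model (`selmerCorank_eq_zpCorank_selmerModelInvariants`, file `SelmerCorankPrimeDegreeGalois`)
  transported through `modelIso` (`modelIso_mem_selmerModelInvariants_iff`,
  `selmerAutInvariantsEquiv`).
* **The same group `A` for the three bases `R ⊆ M, L ⊆ F`.** Lemma 4.14 over the base `k = M`
  (or `L`) concerns the curve `E_k` and the Selmer group of `(E_k)_F`; along the equality of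
  Weierstrass equations `(E_k)_F = E_F` (`baseChange_baseChange`) the cohomology groups, Selmer
  groups and actions correspond (`h1PrimaryCongr`, `mem_selmerGroupPInfty_iff_h1PrimaryCongr_mem`,
  `h1PrimaryCongr_autAct`: `σ_*` for `E_k/k` is `(σ|_R)_*` for `E/R`, both being
  `(x, y) ↦ (τ x, τ y)` for the common lift `τ = liftAut σ`), so that
  `rk_p(E/k) = corank (A ∩ Fix(Aut(F/k)|_R))` (`selmerCorank_baseChange_eq_zpCorank_selmerFixed`).
* **Group theory of `G ≅ D_{2p}`** (`p` odd): `Aut(F/M)|_R = ⟨g⟩` for the rotation `g` (its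
  elements have order dividing `p`, hence are rotations, `exists_eq_symm_r_one_pow`, and it has
  `p` elements), `Aut(F/L)|_R = {1, h}` for a reflection `h` (`exists_eq_sr`), `G = ⟨g, h⟩`
  (`exists_eq_pow_or_eq_mul_pow`), `g^p = h² = 1`, `g h g = h` (`symm_r_one_mul_mul_eq`). Hence
  `rk_p(E/M) = corank A^g`, `rk_p(E/L) = corank A^h`, `rk_p(E/R) = corank A^{g,h}`,
  `rk_p(E/F) = corank A`.
* **Module theory of `D_{2p}`** (tree, file `ZpCorankDihedralAction`:
  `exists_zpCorank_eq_and_zpCorank_fixedSub_eq_of_dihedral`,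
  `zpCorank_eq_zpCorank_fixedSub_add_zpCorank_fixedSub_neg`): `corank A = corank A^g + (p-1) m_ρ`,
  `corank A^h = corank A^{g,h} + (p-1)/2 m_ρ`, `corank A^g = corank A^{g,h} + corank (A^g)^{-h}` —
  the shadow on `ℤ_p`-coranks of `X ≅ 1^{m_1} ⊕ ε^{m_ε} ⊕ ρ^{m_ρ}`, with `m_1 = corank A^{g,h}`,
  `m_ε = corank (A^g)^{-h}`.

For `prop417_p27_of_prop417_verbatim`, `L` is taken to be the fixed field of a reflection
(`IntermediateField.fixedField`, of degree `p` over `R` by `finrank_fixedField_eq_card`).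

What remains hypothetical for the named fact is thus exactly: Prop. 4.17 of the source (for
elliptic curves), whose printed proof is the isogeny-invariance machinery of §§4.1–4.3 (Thm. 4.3
after Tate–Milne, Cor. 4.5 with the Cassels–Tate pairing, Thm. 4.7) applied to products of Weil
restrictions, and the CM-point input of Cornut–Vatsal with Tian–Zhang / Nekovář (`hCV`); neither
theory is in the tree. Everything in this file is proved; no named fact is introduced.

## References

* [DokchitserDokchitserAnnals2010] T. Dokchitser, V. Dokchitser, *On the Birch–Swinnerton-Dyer
  quotients modulo squares*, Ann. of Math. 172 (2010), 567–596 = arXiv:math/0610290: Lemma 4.14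
  (p. 24), Prop. 4.17 (p. 25), §4.6 proof of Thm. 4.19 (pp. 26–27) (arXiv: Lemma 47, Prop. 50,
  Thm. 52) — read (held, `paper:dokchitser2010-…`, pp. 24–27).
* [CornutVatsal2007] C. Cornut, V. Vatsal, *Nontriviality of Rankin–Selberg L-functions and CM
  points*, in *L-functions and Galois representations* (Durham 2004), CUP 2007, Thm. 1.5, Thm. 4.2.
* [Nekovar2007] J. Nekovář, *The Euler system method for CM points on Shimura curves*, ibid.,
  Thm. 3.2.
* J.-P. Serre, *Galois Cohomology* (1997), I.§2.4–2.5, II.§1.1 (compatible pairs, conjugation).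
  [SerreGaloisCohomology1997]
-/

noncomputable section

open scoped Classical AddSubgroup

open WeierstrassCurve

namespace Literature.NumberTheory.EllipticCurves

open GaloisRepresentations

universe u

/-! ## Transport of `H¹(F, E[p^∞])` along an equality of Weierstrass equations -/

section Congr

variable {F : Type u} [Field F] {V₁ V₂ : WeierstrassCurve F} (p : ℕ)

/-- `E₁[p^∞] ≃+ E₂[p^∞]` along an equality `V₁ = V₂` of equations (identity on coordinates).
[folklore] -/
def primaryCongr (h : V₁ = V₂) : geomPrimaryTorsion V₁ p ≃+ geomPrimaryTorsion V₂ p :=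
  primaryComponentCongr (geomPointsCongr h) p

/-- Values of `primaryCongr` on underlying points. [folklore] -/
@[simp]
theorem coe_primaryCongr (h : V₁ = V₂) (P : geomPrimaryTorsion V₁ p) :
    (primaryCongr p h P : geomPoints V₂) = geomPointsCongr h P :=
  rfl

/-- `primaryCongr rfl = id`. [folklore] -/
@[simp]
theorem primaryCongr_rfl (P : geomPrimaryTorsion V₁ p) : primaryCongr p (rfl : V₁ = V₁) P = P :=
  rfl

/-- `primaryCongr` is `Γ_F`-equivariant. [folklore] -/
theorem primaryCongr_smul (h : V₁ = V₂) (g : Field.absoluteGaloisGroup F)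
    (P : geomPrimaryTorsion V₁ p) : primaryCongr p h (g • P) = g • primaryCongr p h P := by
  subst h; rfl

/-- **`H¹(F, E₁[p^∞]) ≃+ H¹(F, E₂[p^∞])` along `V₁ = V₂`** (`h1Equiv` of `primaryCongr`).
[folklore] -/
def h1PrimaryCongr (h : V₁ = V₂) : galH1Primary V₁ p ≃+ galH1Primary V₂ p :=
  h1Equiv (primaryCongr p h) (primaryCongr_smul p h)

/-- `h1PrimaryCongr rfl = id`. [folklore] -/
@[simp]
theorem h1PrimaryCongr_rfl (s : galH1Primary V₁ p) : h1PrimaryCongr p (rfl : V₁ = V₁) s = s := by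
  rw [h1PrimaryCongr, h1Equiv_apply]
  have e : resH1Hom (ContinuousMonoidHom.id (Field.absoluteGaloisGroup F))
      ((primaryCongr p (rfl : V₁ = V₁) : geomPrimaryTorsion V₁ p ≃+ geomPrimaryTorsion V₁ p) :
        geomPrimaryTorsion V₁ p →+ geomPrimaryTorsion V₁ p) (primaryCongr_smul p rfl) =
      resH1Hom (ContinuousMonoidHom.id _) (AddMonoidHom.id _) (fun _ _ ↦ rfl) :=
    resH1Hom_congr rfl (by ext P; rfl) _ _
  rw [e, resH1Hom_id]
  rfl

/-- **The `p^∞`-Selmer groups correspond** along `V₁ = V₂`. [folklore] -/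
theorem mem_selmerGroupPInfty_iff_h1PrimaryCongr_mem [NumberField F] (h : V₁ = V₂)
    (s : galH1Primary V₁ p) :
    s ∈ selmerGroupPInfty V₁ p ↔ h1PrimaryCongr p h s ∈ selmerGroupPInfty V₂ p := by
  subst h; rw [h1PrimaryCongr_rfl]

/-- **Maps of compatible pairs intertwined by `primaryCongr` correspond under `h1PrimaryCongr`.**
[folklore] -/
theorem h1PrimaryCongr_resH1Hom (h : V₁ = V₂)
    {φ₁ φ₂ : Field.absoluteGaloisGroup F →ₜ* Field.absoluteGaloisGroup F} (hφ : φ₁ = φ₂)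
    (f₁ : geomPrimaryTorsion V₁ p →+ geomPrimaryTorsion V₁ p)
    (hf₁ : ∀ (x : Field.absoluteGaloisGroup F) (m : geomPrimaryTorsion V₁ p), f₁ (φ₁ x • m) = x • f₁ m)
    (f₂ : geomPrimaryTorsion V₂ p →+ geomPrimaryTorsion V₂ p)
    (hf₂ : ∀ (x : Field.absoluteGaloisGroup F) (m : geomPrimaryTorsion V₂ p), f₂ (φ₂ x • m) = x • f₂ m)
    (hc : ∀ P, primaryCongr p h (f₁ P) = f₂ (primaryCongr p h P)) (s : galH1Primary V₁ p) :
    h1PrimaryCongr p h (resH1Hom φ₁ f₁ hf₁ s) = resH1Hom φ₂ f₂ hf₂ (h1PrimaryCongr p h s) := by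
  subst h hφ
  have hf : f₁ = f₂ := AddMonoidHom.ext fun P ↦ by simpa using hc P
  subst hf
  rw [h1PrimaryCongr_rfl, h1PrimaryCongr_rfl]

end Congr

/-! ## Lemma 4.14 in the intrinsic field-level form; `σ_*` is multiplicative -/

section Intrinsic

variable {k : Type} [Field k] [NumberField k] (W : WeierstrassCurve k)
variable (F : Type) [Field F] [NumberField F] [Algebra k F] (p : ℕ)

/-- The action `σ_*` of `σ ∈ Aut(F/k)` on `H¹(F, E_F[p^∞])` for `E = W/k`, through the chosen lift
`liftAut σ` of `σ` to `F̄` (`IsLiftOfAut.relConjH1Primary`). Dokchitser–Dokchitser 2010, Lemma 4.14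
(`X_p(E/F)` as a `G`-representation). [cite: DokchitserDokchitserAnnals2010, Lemma 4.14] -/
abbrev autAct (σ : F ≃ₐ[k] F) : galH1Primary (W.baseChange F) p →+ galH1Primary (W.baseChange F) p :=
  (isLiftOfAut_liftAut σ).relConjH1Primary W p

/-- **`Sel_{p^∞}(E_F/F)^{Gal(F/k)}`**, intrinsically: the Selmer classes over `F` fixed by `σ_*` for
every `σ ∈ Aut(F/k)`. Dokchitser–Dokchitser 2010, Lemma 4.14 (`X_p(E/F)^G`).
[cite: DokchitserDokchitserAnnals2010, Lemma 4.14] -/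
def selmerAutInvariants : AddSubgroup (galH1Primary (W.baseChange F) p) :=
  selmerGroupPInfty (W.baseChange F) p ⊓ ⨅ σ : F ≃ₐ[k] F, (autAct W F p σ - AddMonoidHom.id _).ker

omit [NumberField k] in
/-- Membership in `Sel_{p^∞}(E_F/F)^{Gal(F/k)}`. [folklore] -/
theorem mem_selmerAutInvariants_iff (s : galH1Primary (W.baseChange F) p) :
    s ∈ selmerAutInvariants W F p ↔
      s ∈ selmerGroupPInfty (W.baseChange F) p ∧ ∀ σ : F ≃ₐ[k] F, autAct W F p σ s = s := by
  simp only [selmerAutInvariants, AddSubgroup.mem_inf, AddSubgroup.mem_iInf, AddMonoidHom.mem_ker,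
    AddMonoidHom.sub_apply, AddMonoidHom.id_apply, sub_eq_zero]

variable [IsGalois k F]

/-- **Under the subgroup model, `Sel^{Aut}` is `T^G`**: `modelIso s ∈ T^G ↔ s ∈ Sel_{p^∞}(E_F/F)^{Gal(F/k)}`
(`modelIso ∘ σ_* = (c_σ)_* ∘ modelIso`, `RelModel.modelIso_relConjH1Primary`; every `g ∈ Γ_k` is
`c_σ n` with `n ∈ galRange F` acting trivially). [cite: DokchitserDokchitserAnnals2010, Lemma 4.14] -/
theorem modelIso_mem_selmerModelInvariants_iff (s : galH1Primary (W.baseChange F) p) :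
    modelIso F W p s ∈ selmerModelInvariants W F p ↔ s ∈ selmerAutInvariants W F p := by
  haveI := RelModel.normal_galRange (K := k) F
  rw [mem_selmerModelInvariants_iff, mem_selmerAutInvariants_iff, mem_selmerModel_iff,
    AddEquiv.symm_apply_apply]
  refine and_congr Iff.rfl ⟨fun h σ ↦ ?_, fun h g ↦ ?_⟩
  · apply (modelIso F W p).injective
    rw [RelModel.modelIso_relConjH1Primary F W p σ s]
    exact h _
  · obtain ⟨σ₀, hn⟩ := RelModel.exists_liftToAbsGal_inv_mul_mem_galRange (K := k) F g
    have hg : g = liftToAbsGal (K := k) F σ₀ * ((liftToAbsGal (K := k) F σ₀)⁻¹ * g) :=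
      (mul_inv_cancel_left _ _).symm
    rw [hg, conjH1_mul_holds _ _, AddMonoidHom.comp_apply, conjH1_of_mem_holds _ _ hn,
      AddMonoidHom.id_apply, ← RelModel.modelIso_relConjH1Primary F W p σ₀ s, h σ₀]

/-- `Sel_{p^∞}(E_F/F)^{Gal(F/k)} ≃+ T^G` (restriction of `modelIso`). [folklore] -/
def selmerAutInvariantsEquiv : selmerAutInvariants W F p ≃+ selmerModelInvariants W F p :=
  ((modelIso F W p).addSubgroupMap (selmerAutInvariants W F p)).trans
    (AddEquiv.addSubgroupCongr (by
      ext t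
      constructor
      · rintro ⟨s, hs, rfl⟩
        exact (modelIso_mem_selmerModelInvariants_iff W F p s).mpr hs
      · intro ht
        refine ⟨(modelIso F W p).symm t, ?_, AddEquiv.apply_symm_apply _ _⟩
        have h := modelIso_mem_selmerModelInvariants_iff W F p ((modelIso F W p).symm t)
        rw [AddEquiv.apply_symm_apply] at h
        exact h.mp ht))

variable [W.IsElliptic] [Fact p.Prime]

/-- **Dokchitser–Dokchitser 2010, Lemma 4.14, intrinsic field-level form**: for an elliptic curve
`E = W` over a number field `k`, a finite Galois extension `F/k` and a prime `p`,
`rk_p(E/k) = corank_{ℤ_p} Sel_{p^∞}(E_F/F)^{Gal(F/k)}`, the invariants being taken for the action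
`σ_*` of `Aut(F/k)` on `H¹(F, E_F[p^∞])` ("`rk_p(E/K) = dim_{ℚ_p} X_p(E/F)^G`"; the tree's
`selmerCorank_eq_zpCorank_selmerModelInvariants` is the same statement in the subgroup model).
[cite: DokchitserDokchitserAnnals2010, Lemma 4.14] -/
theorem selmerCorank_eq_zpCorank_selmerAutInvariants :
    W.selmerCorank p = zpCorank (selmerAutInvariants W F p) p := by
  rw [selmerCorank_eq_zpCorank_selmerModelInvariants W F p]
  exact (zpCorank_congr (selmerAutInvariantsEquiv W F p) p).symm

omit [W.IsElliptic] [Fact p.Prime] in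
/-- `(c_{σσ'})⁻¹ c_σ c_{σ'} ∈ galRange F`: the transported lifts are multiplicative modulo
`galRange F` (all three act on the copy `j(F) ⊆ k̄` through `Aut(F/k)`). [folklore] -/
theorem liftToAbsGal_mul_inv_mul_mem_galRange (σ σ' : F ≃ₐ[k] F) :
    (liftToAbsGal (K := k) F (σ * σ'))⁻¹ * (liftToAbsGal (K := k) F σ * liftToAbsGal (K := k) F σ') ∈
      galRange (K := k) F := by
  obtain ⟨σ₀, hn⟩ := RelModel.exists_liftToAbsGal_inv_mul_mem_galRange (K := k) F
    (liftToAbsGal (K := k) F σ * liftToAbsGal (K := k) F σ')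
  suffices hσ₀ : σ₀ = σ * σ' by subst hσ₀; exact hn
  ext x
  apply (embIntoClosure (K := k) F).injective
  have h := smul_embIntoClosure_of_mem_galRange F hn x
  change (show AlgebraicClosure k ≃ₐ[k] AlgebraicClosure k from liftToAbsGal (K := k) F σ₀).symm
      ((show AlgebraicClosure k ≃ₐ[k] AlgebraicClosure k from liftToAbsGal (K := k) F σ)
        ((show AlgebraicClosure k ≃ₐ[k] AlgebraicClosure k from liftToAbsGal (K := k) F σ')
          (embIntoClosure (K := k) F x))) = embIntoClosure (K := k) F x at h
  rw [liftToAbsGal_embIntoClosure, liftToAbsGal_embIntoClosure, AlgEquiv.symm_apply_eq,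
    liftToAbsGal_embIntoClosure] at h
  rw [AlgEquiv.mul_apply]
  exact h.symm

omit [W.IsElliptic] [Fact p.Prime] in
/-- **`σ_*` is multiplicative**: `(σσ')_* = σ_* ∘ σ'_*` on `H¹(F, E_F[p^∞])` (in the model both are
conjugation by elements of the same coset of `galRange F`). [folklore] -/
theorem autAct_mul (σ σ' : F ≃ₐ[k] F) :
    autAct W F p (σ * σ') = (autAct W F p σ).comp (autAct W F p σ') := by
  haveI := RelModel.normal_galRange (K := k) F
  refine AddMonoidHom.ext fun s ↦ (modelIso F W p).injective ?_
  rw [AddMonoidHom.comp_apply, RelModel.modelIso_relConjH1Primary F W p (σ * σ') s,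
    RelModel.modelIso_relConjH1Primary F W p σ, RelModel.modelIso_relConjH1Primary F W p σ' s,
    ← AddMonoidHom.comp_apply (conjH1 _ _ _), ← conjH1_mul_holds _ _]
  have hg : liftToAbsGal (K := k) F σ * liftToAbsGal (K := k) F σ' =
      liftToAbsGal (K := k) F (σ * σ') *
        ((liftToAbsGal (K := k) F (σ * σ'))⁻¹ * (liftToAbsGal (K := k) F σ * liftToAbsGal (K := k) F σ')) :=
    (mul_inv_cancel_left _ _).symm
  rw [hg, conjH1_mul_holds _ _, AddMonoidHom.comp_apply,
    conjH1_of_mem_holds _ _ (liftToAbsGal_mul_inv_mul_mem_galRange F σ σ'), AddMonoidHom.id_apply]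

omit [W.IsElliptic] [Fact p.Prime] in
/-- `1_* = id` on `H¹(F, E_F[p^∞])`. [folklore] -/
theorem autAct_one : autAct W F p (1 : F ≃ₐ[k] F) = AddMonoidHom.id _ := by
  haveI := RelModel.normal_galRange (K := k) F
  refine AddMonoidHom.ext fun s ↦ (modelIso F W p).injective ?_
  rw [RelModel.modelIso_relConjH1Primary F W p 1 s, AddMonoidHom.id_apply]
  have h1 : liftToAbsGal (K := k) F (1 : F ≃ₐ[k] F) ∈ galRange (K := k) F := by
    have h := liftToAbsGal_mul_inv_mul_mem_galRange F (1 : F ≃ₐ[k] F) 1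
    rwa [mul_one, inv_mul_cancel_left] at h
  rw [conjH1_of_mem_holds _ _ h1, AddMonoidHom.id_apply]

omit [W.IsElliptic] [Fact p.Prime] in
/-- `(σ^n)_* = (σ_*)^n`, as iterates. [folklore] -/
theorem autAct_pow_apply (σ : F ≃ₐ[k] F) (n : ℕ) (s : galH1Primary (W.baseChange F) p) :
    autAct W F p (σ ^ n) s = (autAct W F p σ)^[n] s := by
  induction n generalizing s with
  | zero => rw [pow_zero, autAct_one, Function.iterate_zero]; rfl
  | succ n ih =>
    rw [pow_succ, autAct_mul, AddMonoidHom.comp_apply, ih, Function.iterate_succ_apply]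

omit [W.IsElliptic] [Fact p.Prime] in
/-- A class fixed by `σ_*` is fixed by `(σ^n)_*`. [folklore] -/
theorem autAct_pow_eq_self {σ : F ≃ₐ[k] F} {s : galH1Primary (W.baseChange F) p}
    (h : autAct W F p σ s = s) (n : ℕ) : autAct W F p (σ ^ n) s = s := by
  rw [autAct_pow_apply]
  exact Function.iterate_fixed h n

end Intrinsic

/-! ## Changing the base of the curve: `E/R` versus `E_k/k` for `R ⊆ k ⊆ F` -/

section CrossBase

variable {R k F : Type} [Field R] [Field k] [Field F] [Algebra R k] [Algebra k F] [Algebra R F]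
  [IsScalarTower R k F] (W : WeierstrassCurve R) (p : ℕ)

/-- The chosen lift of `σ ∈ Aut(F/k)` only depends on the ring automorphism `σ`. [folklore] -/
theorem liftAut_restrictScalars (σ : F ≃ₐ[k] F) : liftAut (σ.restrictScalars R) = liftAut σ := rfl

/-- The Galois sides of `σ_*` over `k` and over `R` agree. [folklore] -/
theorem conjGalCMH_restrictScalars (σ : F ≃ₐ[k] F) :
    (isLiftOfAut_liftAut (σ.restrictScalars R)).conjGalCMH = (isLiftOfAut_liftAut σ).conjGalCMH := by
  apply ContinuousMonoidHom.ext
  intro g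
  rfl

/-- The coefficient sides of `σ_*` over `k` (curve `E_k`) and over `R` (curve `E`) agree along
`(E_k)_F = E_F`: both are `(x, y) ↦ (τ x, τ y)` for the common lift `τ`. [folklore] -/
theorem primaryCongr_relPrimaryTorsionMap (σ : F ≃ₐ[k] F)
    (P : geomPrimaryTorsion ((W.baseChange k).baseChange F) p) :
    primaryCongr p (baseChange_baseChange W k F)
        ((isLiftOfAut_liftAut σ).relPrimaryTorsionMap (W.baseChange k) p P) =
      (isLiftOfAut_liftAut (σ.restrictScalars R)).relPrimaryTorsionMap W p
        (primaryCongr p (baseChange_baseChange W k F) P) := by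
  apply Subtype.ext
  rw [coe_primaryCongr, IsLiftOfAut.coe_relPrimaryTorsionMap, IsLiftOfAut.coe_relPrimaryTorsionMap,
    coe_primaryCongr]
  generalize (P : geomPoints ((W.baseChange k).baseChange F)) = Q
  change (((W.baseChange k).baseChange F).baseChange (AlgebraicClosure F)).toAffine.Point at Q
  rcases Q with _ | ⟨x, y, hxy⟩
  · change geomPointsCongr _ ((isLiftOfAut_liftAut σ).pointsMap (W.baseChange k) 0) =
      (isLiftOfAut_liftAut (σ.restrictScalars R)).pointsMap W (geomPointsCongr _ 0)
    simp only [map_zero]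
  · obtain ⟨h1, e1⟩ := RelModel.pointsMap_some (isLiftOfAut_liftAut σ) (W.baseChange k) hxy
    rw [e1, geomPointsCongr_some, geomPointsCongr_some]
    obtain ⟨h2, e2⟩ := RelModel.pointsMap_some (isLiftOfAut_liftAut (σ.restrictScalars R)) W
      (x := x) (y := y) ((baseChange_baseChange W k F) ▸ hxy)
    exact e2.symm ▸ rfl

/-- **`σ_*` for `E_k/k` is `σ_*` for `E/R`** along `H¹(F, (E_k)_F[p^∞]) ≃ H¹(F, E_F[p^∞])`, for
`σ ∈ Aut(F/k) ⊆ Aut(F/R)`. [folklore] -/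
theorem h1PrimaryCongr_autAct (σ : F ≃ₐ[k] F) (s : galH1Primary ((W.baseChange k).baseChange F) p) :
    h1PrimaryCongr p (baseChange_baseChange W k F) (autAct (W.baseChange k) F p σ s) =
      autAct W F p (σ.restrictScalars R) (h1PrimaryCongr p (baseChange_baseChange W k F) s) := by
  rw [autAct, autAct, IsLiftOfAut.relConjH1Primary, IsLiftOfAut.relConjH1Primary]
  exact h1PrimaryCongr_resH1Hom p (baseChange_baseChange W k F) (conjGalCMH_restrictScalars σ).symm
    _ _ _ _ (primaryCongr_relPrimaryTorsionMap W p σ) s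

end CrossBase

/-! ## Elements of a group isomorphic to `D_{2p}`, `p` an odd prime -/

section DihedralGroupFacts

open DihedralGroup

variable {G : Type*} [Group G] {p : ℕ} [hp : Fact p.Prime] (e : G ≃* DihedralGroup p)

/-- The rotation `g = e⁻¹(r 1)` has order `p`. [folklore] -/
theorem orderOf_symm_r_one : orderOf (e.symm (r 1)) = p := by
  rw [MulEquiv.orderOf_eq]
  exact orderOf_r_one

/-- `g^p = 1`. [folklore] -/
theorem symm_r_one_pow_eq_one : e.symm (r 1) ^ p = 1 := by
  have h := pow_orderOf_eq_one (e.symm (r 1))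
  rwa [orderOf_symm_r_one e] at h

/-- `e⁻¹ (r i) = g^(i.val)`. [folklore] -/
theorem symm_r_eq_pow (i : ZMod p) : e.symm (r i) = e.symm (r 1) ^ i.val := by
  haveI : NeZero p := ⟨hp.out.ne_zero⟩
  rw [← map_pow, r_one_pow, ZMod.natCast_zmod_val]

/-- **An element with `x^p = 1` is a power of the rotation** (`p` odd): reflections have order `2`.
[folklore] -/
theorem exists_eq_symm_r_one_pow (hp2 : p ≠ 2) {x : G} (hx : x ^ p = 1) :
    ∃ a : ℕ, x = e.symm (r 1) ^ a := by
  obtain ⟨m, hm⟩ := hp.out.odd_of_ne_two hp2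
  have hex : e x ^ p = 1 := by rw [← map_pow, hx, map_one]
  rcases hex' : e x with i | i
  · refine ⟨i.val, ?_⟩
    rw [← symm_r_eq_pow, ← hex', MulEquiv.symm_apply_apply]
  · have hp' : (sr i : DihedralGroup p) ^ p = sr i := by
      rw [show (sr i : DihedralGroup p) ^ p = sr i ^ (2 * m + 1) by rw [← hm], pow_succ, pow_mul,
        sq, sr_mul_self, one_pow, one_mul]
    rw [hex', hp', one_def] at hex
    cases hex

/-- **A non-trivial element with `x² = 1` is a reflection** (`p` odd). [folklore] -/
theorem exists_eq_sr (hp2 : p ≠ 2) {x : G} (hx1 : x ≠ 1) (hx : x * x = 1) : ∃ i, e x = sr i := by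
  rcases hex : e x with i | i
  · exfalso
    apply hx1
    have h2 : e (x * x) = 1 := by rw [hx, map_one]
    rw [map_mul, hex, r_mul_r, one_def] at h2
    have hi : i + i = 0 := r.inj h2
    have h2ne : (2 : ZMod p) ≠ 0 := by
      intro h0
      have h0' : ((2 : ℕ) : ZMod p) = 0 := by exact_mod_cast h0
      rw [ZMod.natCast_eq_zero_iff] at h0'
      exact hp2 ((Nat.prime_dvd_prime_iff_eq hp.out Nat.prime_two).mp h0')
    have hi0 : i = 0 := by
      rw [← two_mul] at hi
      exact (mul_eq_zero.mp hi).resolve_left h2ne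
    apply e.injective
    rw [hex, hi0, map_one, one_def]
  · exact ⟨i, rfl⟩

/-- `g h g = h` for the rotation `g = e⁻¹(r 1)` and any reflection `h`. [folklore] -/
theorem symm_r_one_mul_mul_eq {h : G} {i : ZMod p} (hh : e h = sr i) :
    e.symm (r 1) * h * e.symm (r 1) = h := by
  apply e.injective
  rw [map_mul, map_mul, MulEquiv.apply_symm_apply, hh, r_mul_sr, sr_mul_r, sub_add_cancel]

/-- **Every element is `g^a` or `h g^a`** for the rotation `g` and a reflection `h`. [folklore] -/
theorem exists_eq_pow_or_eq_mul_pow {h : G} {i : ZMod p} (hh : e h = sr i) (x : G) :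
    ∃ a : ℕ, x = e.symm (r 1) ^ a ∨ x = h * e.symm (r 1) ^ a := by
  rcases hex : e x with j | j
  · refine ⟨j.val, Or.inl ?_⟩
    rw [← symm_r_eq_pow, ← hex, MulEquiv.symm_apply_apply]
  · refine ⟨(j - i).val, Or.inr ?_⟩
    rw [← symm_r_eq_pow]
    apply e.injective
    rw [hex, map_mul, hh, MulEquiv.apply_symm_apply, sr_mul_r, add_sub_cancel]

end DihedralGroupFacts

/-! ## `Sel_{p^∞}(E_F/F)` as a `Gal(F/R)`-module and the dihedral bookkeeping of p. 26 -/

section Dihedral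

variable {R : Type} [Field R] [NumberField R] (W : WeierstrassCurve R)
variable (F : Type) [Field F] [NumberField F] [Algebra R F] (p : ℕ)

/-- `Sel_{p^∞}(E_F/F) ∩ Fix(T)`: the Selmer classes fixed by `τ_*` for all `τ` in a set
`T ⊆ Aut(F/R)`. [folklore] -/
def selmerFixed (T : Set (F ≃ₐ[R] F)) : AddSubgroup (galH1Primary (W.baseChange F) p) :=
  selmerGroupPInfty (W.baseChange F) p ⊓ ⨅ τ ∈ T, (autAct W F p τ - AddMonoidHom.id _).ker

omit [NumberField R] in
/-- Membership in `Sel ∩ Fix(T)`. [folklore] -/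
theorem mem_selmerFixed_iff (T : Set (F ≃ₐ[R] F)) (s : galH1Primary (W.baseChange F) p) :
    s ∈ selmerFixed W F p T ↔
      s ∈ selmerGroupPInfty (W.baseChange F) p ∧ ∀ τ ∈ T, autAct W F p τ s = s := by
  simp only [selmerFixed, AddSubgroup.mem_inf, AddSubgroup.mem_iInf, AddMonoidHom.mem_ker,
    AddMonoidHom.sub_apply, AddMonoidHom.id_apply, sub_eq_zero]

omit [NumberField R] in
/-- `Sel^{Aut(F/R)} = Sel ∩ Fix(univ)`. [folklore] -/
theorem selmerAutInvariants_eq_selmerFixed_univ :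
    selmerAutInvariants W F p = selmerFixed W F p Set.univ := by
  ext s
  rw [mem_selmerAutInvariants_iff, mem_selmerFixed_iff]
  simp only [Set.mem_univ, forall_const]

omit [NumberField R] in
/-- `Sel ∩ Fix(T) = Sel ∩ Fix(T')` when each set fixes what the other fixes. [folklore] -/
theorem selmerFixed_eq_of_forall {T T' : Set (F ≃ₐ[R] F)}
    (h₁ : ∀ s ∈ selmerGroupPInfty (W.baseChange F) p, (∀ τ ∈ T, autAct W F p τ s = s) →
      ∀ τ ∈ T', autAct W F p τ s = s)
    (h₂ : ∀ s ∈ selmerGroupPInfty (W.baseChange F) p, (∀ τ ∈ T', autAct W F p τ s = s) →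
      ∀ τ ∈ T, autAct W F p τ s = s) :
    selmerFixed W F p T = selmerFixed W F p T' := by
  ext s
  rw [mem_selmerFixed_iff, mem_selmerFixed_iff]
  exact ⟨fun h ↦ ⟨h.1, h₁ s h.1 h.2⟩, fun h ↦ ⟨h.1, h₂ s h.1 h.2⟩⟩

omit [NumberField R] in
/-- **The invariants over an intermediate base `k`, transported**: along
`H¹(F, (E_k)_F[p^∞]) ≃ H¹(F, E_F[p^∞])`, `Sel_{p^∞}((E_k)_F/F)^{Aut(F/k)}` becomes
`Sel_{p^∞}(E_F/F) ∩ Fix(Aut(F/k)|_R)`. [folklore] -/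
theorem map_h1PrimaryCongr_selmerAutInvariants (k : Type) [Field k] [NumberField k] [Algebra R k]
    [Algebra k F] [IsScalarTower R k F] :
    (selmerAutInvariants (W.baseChange k) F p).map
        (h1PrimaryCongr p (baseChange_baseChange W k F) :
          galH1Primary ((W.baseChange k).baseChange F) p →+ galH1Primary (W.baseChange F) p) =
      selmerFixed W F p (Set.range (AlgEquiv.restrictScalars R : (F ≃ₐ[k] F) → (F ≃ₐ[R] F))) := by
  ext t
  constructor
  · rintro ⟨s, hs, rfl⟩
    rw [SetLike.mem_coe, mem_selmerAutInvariants_iff] at hs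
    rw [AddMonoidHom.coe_coe, mem_selmerFixed_iff]
    refine ⟨(mem_selmerGroupPInfty_iff_h1PrimaryCongr_mem p _ s).mp hs.1, ?_⟩
    rintro τ ⟨σ, rfl⟩
    rw [← h1PrimaryCongr_autAct, hs.2 σ]
  · intro ht
    rw [mem_selmerFixed_iff] at ht
    refine ⟨(h1PrimaryCongr p (baseChange_baseChange W k F)).symm t, ?_, AddEquiv.apply_symm_apply _ _⟩
    rw [SetLike.mem_coe, mem_selmerAutInvariants_iff]
    refine ⟨?_, fun σ ↦ ?_⟩
    · rw [mem_selmerGroupPInfty_iff_h1PrimaryCongr_mem p (baseChange_baseChange W k F),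
        AddEquiv.apply_symm_apply]
      exact ht.1
    · apply (h1PrimaryCongr p (baseChange_baseChange W k F)).injective
      rw [h1PrimaryCongr_autAct, AddEquiv.apply_symm_apply]
      exact ht.2 _ ⟨σ, rfl⟩

variable [IsGalois R F] [W.IsElliptic] [Fact p.Prime]

omit [NumberField R] in
/-- **`rk_p(E/k) = corank (Sel_{p^∞}(E_F/F) ∩ Fix(Aut(F/k)))`** for `R ⊆ k ⊆ F`, `F/R` Galois
(Lemma 4.14 over `k`, `selmerCorank_eq_zpCorank_selmerAutInvariants`, transported).
[cite: DokchitserDokchitserAnnals2010, Lemma 4.14] -/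
theorem selmerCorank_baseChange_eq_zpCorank_selmerFixed (k : Type) [Field k] [NumberField k]
    [Algebra R k] [Algebra k F] [IsScalarTower R k F] :
    (W.baseChange k).selmerCorank p = zpCorank (selmerFixed W F p
      (Set.range (AlgEquiv.restrictScalars R : (F ≃ₐ[k] F) → (F ≃ₐ[R] F)))) p := by
  haveI : IsGalois k F := IsGalois.tower_top_of_isGalois R k F
  rw [selmerCorank_eq_zpCorank_selmerAutInvariants (W.baseChange k) F p]
  exact zpCorank_congr (((h1PrimaryCongr p (baseChange_baseChange W k F)).addSubgroupMap
    (selmerAutInvariants (W.baseChange k) F p)).trans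
      (AddEquiv.addSubgroupCongr (map_h1PrimaryCongr_selmerAutInvariants W F p k))) p

/-- The restriction of `σ_*` to `Sel_{p^∞}(E_F/F)` (`p` odd: the Selmer group is `Aut(F/R)`-stable,
`relConjH1Primary_mem_selmerGroupPInfty`), an element of `End(Sel_{p^∞}(E_F/F))`.
[cite: DokchitserDokchitserAnnals2010, Lemma 4.14] -/
def selmerEnd (hp2 : p ≠ 2) (σ : F ≃ₐ[R] F) : AddMonoid.End (selmerGroupPInfty (W.baseChange F) p) :=
  ((autAct W F p σ).comp (selmerGroupPInfty (W.baseChange F) p).subtype).codRestrict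
    (selmerGroupPInfty (W.baseChange F) p)
    fun s ↦ relConjH1Primary_mem_selmerGroupPInfty W p hp2 (isLiftOfAut_liftAut σ) s.2

omit [NumberField R] [IsGalois R F] [W.IsElliptic] in
/-- Values of `selmerEnd`. [folklore] -/
@[simp]
theorem coe_selmerEnd_apply (hp2 : p ≠ 2) (σ : F ≃ₐ[R] F) (s : selmerGroupPInfty (W.baseChange F) p) :
    ((selmerEnd W F p hp2 σ s : selmerGroupPInfty (W.baseChange F) p) : galH1Primary (W.baseChange F) p) =
      autAct W F p σ s :=
  rfl

omit [W.IsElliptic] in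
/-- `selmerEnd` is multiplicative. [folklore] -/
theorem selmerEnd_mul (hp2 : p ≠ 2) (σ σ' : F ≃ₐ[R] F) :
    selmerEnd W F p hp2 (σ * σ') = selmerEnd W F p hp2 σ * selmerEnd W F p hp2 σ' := by
  refine DFunLike.ext _ _ fun s ↦ Subtype.ext ?_
  rw [coe_selmerEnd_apply, autAct_mul]
  rfl

omit [W.IsElliptic] in
/-- `selmerEnd 1 = 1`. [folklore] -/
theorem selmerEnd_one (hp2 : p ≠ 2) : selmerEnd W F p hp2 (1 : F ≃ₐ[R] F) = 1 := by
  refine DFunLike.ext _ _ fun s ↦ Subtype.ext ?_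
  rw [coe_selmerEnd_apply, autAct_one]
  rfl

omit [W.IsElliptic] in
/-- `selmerEnd` on powers. [folklore] -/
theorem selmerEnd_pow (hp2 : p ≠ 2) (σ : F ≃ₐ[R] F) (n : ℕ) :
    selmerEnd W F p hp2 (σ ^ n) = selmerEnd W F p hp2 σ ^ n := by
  induction n with
  | zero => rw [pow_zero, pow_zero, selmerEnd_one]
  | succ n ih => rw [pow_succ, pow_succ, selmerEnd_mul, ih]

omit [NumberField R] [IsGalois R F] [W.IsElliptic] in
/-- `Sel ∩ Fix({σ}) ≃+ Sel^{σ_*}` (repackaging). [folklore] -/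
def selmerFixedSingletonEquiv (hp2 : p ≠ 2) (σ : F ≃ₐ[R] F) :
    selmerFixed W F p {σ} ≃+ fixedSub (selmerEnd W F p hp2 σ) where
  toFun s := ⟨⟨(s : galH1Primary (W.baseChange F) p), ((mem_selmerFixed_iff W F p _ _).mp s.2).1⟩,
    (mem_fixedSub_iff _ _).mpr (Subtype.ext (((mem_selmerFixed_iff W F p _ _).mp s.2).2 σ rfl))⟩
  invFun y := ⟨((y : selmerGroupPInfty (W.baseChange F) p) : galH1Primary (W.baseChange F) p),
    (mem_selmerFixed_iff W F p _ _).mpr ⟨(y : selmerGroupPInfty (W.baseChange F) p).2, fun τ hτ ↦ by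
      rw [Set.mem_singleton_iff.mp hτ]
      exact congrArg Subtype.val ((mem_fixedSub_iff _ _).mp y.2)⟩⟩
  left_inv s := Subtype.ext rfl
  right_inv y := Subtype.ext (Subtype.ext rfl)
  map_add' _ _ := Subtype.ext (Subtype.ext rfl)

omit [NumberField R] [IsGalois R F] [W.IsElliptic] in
/-- `Sel ∩ Fix({σ, σ'}) ≃+ Sel^{σ_*} ∩ Sel^{σ'_*}` (repackaging). [folklore] -/
def selmerFixedPairEquiv (hp2 : p ≠ 2) (σ σ' : F ≃ₐ[R] F) :
    selmerFixed W F p {σ, σ'} ≃+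
      ↥(fixedSub (selmerEnd W F p hp2 σ) ⊓ fixedSub (selmerEnd W F p hp2 σ')) where
  toFun s := ⟨⟨(s : galH1Primary (W.baseChange F) p), ((mem_selmerFixed_iff W F p _ _).mp s.2).1⟩,
    AddSubgroup.mem_inf.mpr
      ⟨(mem_fixedSub_iff _ _).mpr (Subtype.ext (((mem_selmerFixed_iff W F p _ _).mp s.2).2 σ (by simp))),
       (mem_fixedSub_iff _ _).mpr (Subtype.ext (((mem_selmerFixed_iff W F p _ _).mp s.2).2 σ' (by simp)))⟩⟩
  invFun y := ⟨((y : selmerGroupPInfty (W.baseChange F) p) : galH1Primary (W.baseChange F) p),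
    (mem_selmerFixed_iff W F p _ _).mpr ⟨(y : selmerGroupPInfty (W.baseChange F) p).2, fun τ hτ ↦ by
      rcases hτ with rfl | hτ
      · exact congrArg Subtype.val ((mem_fixedSub_iff _ _).mp (AddSubgroup.mem_inf.mp y.2).1)
      · rw [Set.mem_singleton_iff.mp hτ]
        exact congrArg Subtype.val ((mem_fixedSub_iff _ _).mp (AddSubgroup.mem_inf.mp y.2).2)⟩⟩
  left_inv s := Subtype.ext rfl
  right_inv y := Subtype.ext (Subtype.ext rfl)
  map_add' _ _ := Subtype.ext (Subtype.ext rfl)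

omit [NumberField R] [NumberField F] [IsGalois R F] [W.IsElliptic] [Fact p.Prime] in
/-- `Aut(F/k) → Aut(F/R)`, `σ ↦ σ|_R`, as a group homomorphism (`AlgEquiv.restrictScalars`).
[folklore] -/
def autRestrictHom (k : Type) [Field k] [Algebra R k] [Algebra k F] [IsScalarTower R k F] :
    (F ≃ₐ[k] F) →* (F ≃ₐ[R] F) where
  toFun := AlgEquiv.restrictScalars R
  map_one' := AlgEquiv.ext fun _ ↦ rfl
  map_mul' _ _ := AlgEquiv.ext fun _ ↦ rfl

omit [NumberField R] [NumberField F] [IsGalois R F] [W.IsElliptic] [Fact p.Prime] in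
/-- Values of `autRestrictHom`. [folklore] -/
@[simp]
theorem autRestrictHom_apply (k : Type) [Field k] [Algebra R k] [Algebra k F] [IsScalarTower R k F]
    (σ : F ≃ₐ[k] F) : autRestrictHom (R := R) F k σ = σ.restrictScalars R :=
  rfl

/-- **Dokchitser–Dokchitser 2010, p. 26 (proof of Thm. 4.19), the `D_{2p}` bookkeeping**: "`H =
Gal(F/K) ≅ D_{2p}` … decompose `X = X_p(E/F) ≅ 1^{m_1} ⊕ ε^{m_ε} ⊕ ρ^{m_ρ}`. As `X_p(E/K) = X^H`
etc. (Lemma 4.14), `rk_p(E/K) = m_1`, `rk_p(E/M) = m_1 + m_ε`, `rk_p(E/L) = m_1 + (p-1)/2 m_ρ`"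
(and `rk_p(E/F) = dim X = m_1 + m_ε + (p - 1) m_ρ`), in the form of the two identities that are
used: for an elliptic curve `E = W` over a number field `R`, an odd prime `p`, a Galois extension
`F/R` with `Gal(F/R) ≅ D_{2p}`, and subextensions `M/R` of degree `2` and `L/R` of degree `p`, there
is `m_ρ ∈ ℕ` with

  `rk_p(E/F) = rk_p(E/M) + (p - 1) m_ρ`  and  `rk_p(E/L) = rk_p(E/R) + (p-1)/2 · m_ρ`;

in particular Prop. 4.17's `2/(p-1) (rk_p(E/L) - rk_p(E/R))` is this `m_ρ`. Proof: Lemma 4.14 in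
the intrinsic form (`selmerCorank_eq_zpCorank_selmerAutInvariants`, over `R`, `M`, `L`, all inside
the one group `A = Sel_{p^∞}(E_F/F)` by `selmerCorank_baseChange_eq_zpCorank_selmerFixed`),
`Aut(F/M)|_R = ⟨g⟩` for the rotation `g`, `Aut(F/L)|_R = {1, h}` for a reflection `h`,
`Aut(F/R) = ⟨g, h⟩`, and the module theory of `D_{2p}`
(`exists_zpCorank_eq_and_zpCorank_fixedSub_eq_of_dihedral`, file `ZpCorankDihedralAction`).
[cite: DokchitserDokchitserAnnals2010, §4.6, proof of Thm. 4.19 (p. 26), with Lemma 4.14 and Prop. 4.17] -/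
theorem exists_selmerCorank_dihedral_display (hp2 : p ≠ 2)
    (e : (F ≃ₐ[R] F) ≃* DihedralGroup p)
    (M : Type) [Field M] [NumberField M] [Algebra R M] [Algebra M F] [IsScalarTower R M F]
    (hM : Module.finrank R M = 2)
    (L : Type) [Field L] [NumberField L] [Algebra R L] [Algebra L F] [IsScalarTower R L F]
    (hL : Module.finrank R L = p) :
    ∃ m₁ mε mρ : ℕ, W.selmerCorank p = m₁ ∧ (W.baseChange M).selmerCorank p = m₁ + mε ∧
      (W.baseChange L).selmerCorank p = m₁ + (p - 1) / 2 * mρ ∧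
        (W.baseChange F).selmerCorank p = m₁ + mε + (p - 1) * mρ := by
  have hprime : p.Prime := Fact.out
  haveI : FiniteDimensional R F := Module.Finite.of_restrictScalars_finite ℚ R F
  -- degrees
  have hRF : Module.finrank R F = 2 * p := by
    rw [← IsGalois.card_aut_eq_finrank, Nat.card_congr e.toEquiv, DihedralGroup.nat_card]
  haveI : IsGalois M F := IsGalois.tower_top_of_isGalois R M F
  haveI : IsGalois L F := IsGalois.tower_top_of_isGalois R L F
  haveI : FiniteDimensional M F := Module.Finite.of_restrictScalars_finite R M F
  haveI : FiniteDimensional L F := Module.Finite.of_restrictScalars_finite R L F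
  haveI : FiniteDimensional R M := Module.Finite.of_restrictScalars_finite ℚ R M
  haveI : FiniteDimensional R L := Module.Finite.of_restrictScalars_finite ℚ R L
  have hMF : Module.finrank M F = p := by
    have h := Module.finrank_mul_finrank R M F
    rw [hRF, hM] at h
    omega
  have hLF : Module.finrank L F = 2 := by
    have h := Module.finrank_mul_finrank R L F
    rw [hRF, hL, mul_comm 2 p] at h
    exact Nat.eq_of_mul_eq_mul_left hprime.pos h
  have hcardM : Nat.card (F ≃ₐ[M] F) = p := (IsGalois.card_aut_eq_finrank M F).trans hMF
  have hcardL : Nat.card (F ≃ₐ[L] F) = 2 := (IsGalois.card_aut_eq_finrank L F).trans hLF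
  -- the rotation `g`
  set g : F ≃ₐ[R] F := e.symm (DihedralGroup.r 1) with hgdef
  have hgp : g ^ p = 1 := symm_r_one_pow_eq_one e
  -- `Aut(F/M)|_R ⊆ ⟨g⟩`
  have hMres : ∀ σ : F ≃ₐ[M] F, ∃ a : ℕ, σ.restrictScalars R = g ^ a := fun σ ↦ by
    apply exists_eq_symm_r_one_pow e hp2
    rw [← autRestrictHom_apply (R := R) F M, ← map_pow, ← hcardM, pow_card_eq_one', map_one]
  -- `g ∈ Aut(F/M)|_R`
  obtain ⟨σM, hσM⟩ : ∃ σM : F ≃ₐ[M] F, σM.restrictScalars R = g := by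
    let f : (F ≃ₐ[M] F) → Subgroup.zpowers g := fun σ ↦ ⟨σ.restrictScalars R, by
      obtain ⟨a, ha⟩ := hMres σ
      rw [ha]
      exact Subgroup.pow_mem _ (Subgroup.mem_zpowers g) a⟩
    have hf : Function.Injective f := fun σ σ' h ↦
      AlgEquiv.restrictScalars_injective R (congrArg Subtype.val h :)
    have hcard : Nat.card (Subgroup.zpowers g) ≤ Nat.card (F ≃ₐ[M] F) := by
      rw [Nat.card_zpowers, hgdef, orderOf_symm_r_one e, hcardM]
    obtain ⟨σM, hσM⟩ := (hf.bijective_of_nat_card_le hcard).2 ⟨g, Subgroup.mem_zpowers g⟩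
    exact ⟨σM, congrArg Subtype.val hσM⟩
  have hMfix : selmerFixed W F p (Set.range (AlgEquiv.restrictScalars R : (F ≃ₐ[M] F) → (F ≃ₐ[R] F))) =
      selmerFixed W F p {g} := by
    refine selmerFixed_eq_of_forall W F p (fun s _ hs τ hτ ↦ ?_) (fun s _ hs τ hτ ↦ ?_)
    · rw [Set.mem_singleton_iff.mp hτ, ← hσM]
      exact hs _ ⟨σM, rfl⟩
    · obtain ⟨σ, rfl⟩ := hτ
      obtain ⟨a, ha⟩ := hMres σ
      rw [ha]
      exact autAct_pow_eq_self W F p (hs g rfl) a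
  -- the reflection `h` generating `Aut(F/L)|_R`
  obtain ⟨σL, hσL1⟩ : ∃ σL : F ≃ₐ[L] F, σL ≠ 1 := by
    have hlt : 1 < Nat.card (F ≃ₐ[L] F) := by rw [hcardL]; exact one_lt_two
    obtain ⟨a, b, hab⟩ := Finite.one_lt_card_iff_nontrivial.mp hlt
    by_cases ha : a = 1
    · exact ⟨b, fun hb ↦ hab (ha.trans hb.symm)⟩
    · exact ⟨a, ha⟩
  have hLall : ∀ σ : F ≃ₐ[L] F, σ = 1 ∨ σ = σL := fun σ ↦ by
    by_cases hσ : σ = 1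
    · exact Or.inl hσ
    · obtain ⟨y, -, hy⟩ := (Nat.card_eq_two_iff' (1 : F ≃ₐ[L] F)).mp hcardL
      exact Or.inr ((hy σ hσ).trans (hy σL hσL1).symm)
  set h : F ≃ₐ[R] F := σL.restrictScalars R with hhdef
  have hh1 : h ≠ 1 := fun h1 ↦ hσL1 (AlgEquiv.restrictScalars_injective R
    (h1.trans (AlgEquiv.ext fun _ ↦ rfl : (1 : F ≃ₐ[R] F) = (1 : F ≃ₐ[L] F).restrictScalars R)))
  have hσL2 : σL * σL = 1 := by rw [← sq, ← hcardL, pow_card_eq_one']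
  have hhh : h * h = 1 := by
    rw [hhdef, ← autRestrictHom_apply (R := R) F L, ← map_mul, hσL2, map_one]
  obtain ⟨i, hi⟩ := exists_eq_sr e hp2 hh1 hhh
  have hLfix : selmerFixed W F p (Set.range (AlgEquiv.restrictScalars R : (F ≃ₐ[L] F) → (F ≃ₐ[R] F))) =
      selmerFixed W F p {h} := by
    refine selmerFixed_eq_of_forall W F p (fun s _ hs τ hτ ↦ ?_) (fun s _ hs τ hτ ↦ ?_)
    · rw [Set.mem_singleton_iff.mp hτ]
      exact hs _ ⟨σL, rfl⟩
    · obtain ⟨σ, rfl⟩ := hτ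
      rcases hLall σ with rfl | rfl
      · rw [show (1 : F ≃ₐ[L] F).restrictScalars R = (1 : F ≃ₐ[R] F) from AlgEquiv.ext fun _ ↦ rfl,
          autAct_one, AddMonoidHom.id_apply]
      · exact hs h rfl
  -- `Aut(F/R) = ⟨g, h⟩`
  have hRfix : selmerAutInvariants W F p = selmerFixed W F p {g, h} := by
    rw [selmerAutInvariants_eq_selmerFixed_univ]
    refine selmerFixed_eq_of_forall W F p (fun s _ hs τ _ ↦ hs τ (Set.mem_univ τ)) (fun s _ hs τ _ ↦ ?_)
    obtain ⟨a, hτ | hτ⟩ := exists_eq_pow_or_eq_mul_pow e hi τ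
    · rw [hτ]
      exact autAct_pow_eq_self W F p (hs g (by simp)) a
    · rw [hτ, autAct_mul, AddMonoidHom.comp_apply, autAct_pow_eq_self W F p (hs g (by simp)) a]
      exact hs h (by simp)
  -- the `D_{2p}`-module `A = Sel_{p^∞}(E_F/F)`
  set σA : AddMonoid.End (selmerGroupPInfty (W.baseChange F) p) := selmerEnd W F p hp2 g with hσAdef
  set τA : AddMonoid.End (selmerGroupPInfty (W.baseChange F) p) := selmerEnd W F p hp2 h with hτAdef
  have hσ : σA ^ p = 1 := by rw [hσAdef, ← selmerEnd_pow, hgp, selmerEnd_one]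
  have hτ : τA ^ 2 = 1 := by rw [hτAdef, sq, ← selmerEnd_mul, hhh, selmerEnd_one]
  have hστ : σA * τA * σA = τA := by
    rw [hσAdef, hτAdef, ← selmerEnd_mul, ← selmerEnd_mul, hgdef, symm_r_one_mul_mul_eq e hi]
  have hA : ∀ a : selmerGroupPInfty (W.baseChange F) p, ∃ n : ℕ, p ^ n • a = 0 := fun a ↦ by
    obtain ⟨n, hn⟩ := exists_pow_nsmul_eq_zero_galH1Primary (W.baseChange F) p
      (a : galH1Primary (W.baseChange F) p)
    exact ⟨n, Subtype.ext (by rw [AddSubmonoidClass.coe_nsmul]; exact hn)⟩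
  haveI : Finite (selmerGroupPInfty (W.baseChange F) p)[(p : ℤ)] :=
    finite_torsionBy_selmerGroupPInfty (W.baseChange F) p
  obtain ⟨mρ, hk1, hk2⟩ :=
    exists_zpCorank_eq_and_zpCorank_fixedSub_eq_of_dihedral hσ hτ hστ hp2 hA
  -- the four coranks
  have hF' : zpCorank (selmerGroupPInfty (W.baseChange F) p) p = (W.baseChange F).selmerCorank p := rfl
  have hM' : zpCorank (fixedSub σA) p = (W.baseChange M).selmerCorank p := by
    rw [selmerCorank_baseChange_eq_zpCorank_selmerFixed W F p M, hMfix,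
      zpCorank_congr (selmerFixedSingletonEquiv W F p hp2 g) p]
  have hL' : zpCorank (fixedSub τA) p = (W.baseChange L).selmerCorank p := by
    rw [selmerCorank_baseChange_eq_zpCorank_selmerFixed W F p L, hLfix,
      zpCorank_congr (selmerFixedSingletonEquiv W F p hp2 h) p]
  have hR' : zpCorank ↥(fixedSub σA ⊓ fixedSub τA) p = W.selmerCorank p := by
    rw [selmerCorank_eq_zpCorank_selmerAutInvariants W F p, hRfix,
      zpCorank_congr (selmerFixedPairEquiv W F p hp2 g h) p]
  -- `m_ε`: `A^σ = (A^σ)^τ ⊕ (A^σ)^{-τ}` up to quasi-isomorphism, `(A^σ)^τ = A^{σ,τ}`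
  obtain ⟨hB, hBfin⟩ := primary_and_finite_torsionBy_of_injective (i := (fixedSub σA).subtype)
    Subtype.val_injective hA
  haveI := hBfin
  set t : AddMonoid.End (fixedSub σA) :=
    ((endHom τA).comp (fixedSub σA).subtype).codRestrict (fixedSub σA)
      (fun x ↦ apply_mem_fixedSub_of_dihedral hστ x.2) with htdef
  have ht_coe : ∀ x : fixedSub σA, ((t x : fixedSub σA) : selmerGroupPInfty (W.baseChange F) p) = τA x :=
    fun x ↦ rfl
  have ht2 : t ^ 2 = 1 := by
    refine DFunLike.ext _ _ fun x ↦ Subtype.ext ?_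
    rw [coe_pow_apply_of_coe_apply τA t ht_coe 2 x, hτ]
    rfl
  have hsplit := zpCorank_eq_zpCorank_fixedSub_add_zpCorank_fixedSub_neg (p := p) ht2 hB
  have hiso : zpCorank (fixedSub t) p = zpCorank ↥(fixedSub σA ⊓ fixedSub τA) p := by
    refine zpCorank_congr (p := p) ?_
    exact
      { toFun := fun x ↦ ⟨((x : fixedSub σA) : selmerGroupPInfty (W.baseChange F) p),
          AddSubgroup.mem_inf.mpr ⟨(x : fixedSub σA).2, (mem_fixedSub_iff _ _).mpr
            ((ht_coe (x : fixedSub σA)).symm.trans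
              (congrArg Subtype.val ((mem_fixedSub_iff t (x : fixedSub σA)).mp x.2)))⟩⟩
        invFun := fun y ↦ ⟨⟨(y : selmerGroupPInfty (W.baseChange F) p), (AddSubgroup.mem_inf.mp y.2).1⟩,
          (mem_fixedSub_iff t _).mpr (Subtype.ext
            ((mem_fixedSub_iff τA (y : selmerGroupPInfty (W.baseChange F) p)).mp
              (AddSubgroup.mem_inf.mp y.2).2))⟩
        left_inv := fun x ↦ Subtype.ext (Subtype.ext rfl)
        right_inv := fun y ↦ Subtype.ext rfl
        map_add' := fun _ _ ↦ Subtype.ext rfl }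
  have e1 : (W.baseChange F).selmerCorank p = zpCorank (fixedSub σA) p + (p - 1) * mρ := hk1
  have e2 : zpCorank (fixedSub σA) p = W.selmerCorank p + zpCorank (fixedSub (-t)) p := by
    rw [hsplit, hiso, hR']
  have e3 : (W.baseChange M).selmerCorank p = W.selmerCorank p + zpCorank (fixedSub (-t)) p :=
    hM'.symm.trans e2
  have e4 : (W.baseChange L).selmerCorank p = W.selmerCorank p + (p - 1) / 2 * mρ := by
    rw [← hL', hk2, hR']
  refine ⟨W.selmerCorank p, zpCorank (fixedSub (-t)) p, mρ, rfl, e3, e4, ?_⟩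
  rw [e1, e2]

/-- **The two identities of the p. 26 bookkeeping that are used**: for `E/R`, `p` odd,
`Gal(F/R) ≅ D_{2p}`, `M/R` quadratic and `L/R` of degree `p` inside `F`, there is `m_ρ ∈ ℕ` with
`rk_p(E/F) = rk_p(E/M) + (p - 1) m_ρ` and `rk_p(E/L) = rk_p(E/R) + (p-1)/2 · m_ρ`; so Prop. 4.17's
`2/(p-1) (rk_p(E/L) - rk_p(E/R))` is the `m_ρ` of p. 27 (from `exists_selmerCorank_dihedral_display`).
[cite: DokchitserDokchitserAnnals2010, §4.6, proof of Thm. 4.19 (p. 26), with Lemma 4.14 and Prop. 4.17] -/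
theorem exists_selmerCorank_baseChange_dihedral_eq (hp2 : p ≠ 2)
    (e : (F ≃ₐ[R] F) ≃* DihedralGroup p)
    (M : Type) [Field M] [NumberField M] [Algebra R M] [Algebra M F] [IsScalarTower R M F]
    (hM : Module.finrank R M = 2)
    (L : Type) [Field L] [NumberField L] [Algebra R L] [Algebra L F] [IsScalarTower R L F]
    (hL : Module.finrank R L = p) :
    ∃ mρ : ℕ, (W.baseChange F).selmerCorank p = (W.baseChange M).selmerCorank p + (p - 1) * mρ ∧
      (W.baseChange L).selmerCorank p = W.selmerCorank p + (p - 1) / 2 * mρ := by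
  obtain ⟨m₁, mε, mρ, h₁, hM', hL', hF'⟩ := exists_selmerCorank_dihedral_display W F p hp2 e M hM L hL
  exact ⟨mρ, by rw [hF', hM'], by rw [hL', h₁]⟩

end Dihedral

/-! ## Prop. 4.17 verbatim ⇒ the p. 27 display ⇒ the named fact -/

section Verbatim

open IntermediateField

/-- **Prop. 4.17 as printed implies Prop. 4.17 in the form invoked on p. 27.** Hypothesis `h417V`:
Dokchitser–Dokchitser 2010, Prop. 4.17 (p. 25), for elliptic curves, verbatim — "Suppose
`Gal(F/K) = D_{2p}` with `p` an odd prime, and pick extensions `M/K` and `L/K` in `F` of degree `2`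
and `p`, respectively. For every [elliptic curve] `A/K`,
`rk_p(A/M) + 2/(p-1) (rk_p(A/L) - rk_p(A/K)) ≡ ord_p C(A/F)/C(A/M) (mod 2)`" (base field named
`R`; `rk_p = selmerCorank`, `C = modifiedTamagawaProduct` for the same `R`-model; the rational
number `2/(p-1)(…)`, an integer by Lemma 4.14, is written with integer division). Conclusion: the
hypothesis `h417D` of `dokchitser_selmerCorank_baseChange_mod_two_eq_of_prop417_dihedral_of_hCV`
(file `BSDSelmerParityDokchitserDihedralProofs`), i.e. the p. 27 display
"`rk_p(E/M) + m_ρ ≡ ord_p C(E/F)/C(E/M) (mod 2)`" with `m_ρ` characterised by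
`rk_p(E/F) = rk_p(E/M) + (p-1) m_ρ`. Proof: take `L = F^{⟨h⟩}` for a reflection `h` (degree `p`
over `R`, `IntermediateField.finrank_fixedField_eq_card`) and use the bookkeeping
`exists_selmerCorank_baseChange_dihedral_eq` ("`rk_p(E/L) = m_1 + (p-1)/2 m_ρ`", p. 26) to
identify `2/(p-1)(rk_p(E/L) - rk_p(E/R))` with `m_ρ`.
[cite: DokchitserDokchitserAnnals2010, Prop. 4.17 (p. 25); §4.6 pp. 26–27] -/
theorem prop417_p27_of_prop417_verbatim
    (h417V : ∀ (p : ℕ) [Fact p.Prime], p ≠ 2 →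
      ∀ (R : Type) [Field R] [NumberField R] (F : Type) [Field F] [NumberField F] [Algebra R F]
        [IsGalois R F], Nonempty ((F ≃ₐ[R] F) ≃* DihedralGroup p) →
        ∀ (M : Type) [Field M] [NumberField M] [Algebra R M] [Algebra M F] [IsScalarTower R M F],
          Module.finrank R M = 2 →
        ∀ (L : Type) [Field L] [NumberField L] [Algebra R L] [Algebra L F] [IsScalarTower R L F],
          Module.finrank R L = p →
          ∀ (E : WeierstrassCurve R) [E.IsElliptic],
            ((E.baseChange M).selmerCorank p : ℤ) +
                2 * (((E.baseChange L).selmerCorank p : ℤ) - (E.selmerCorank p : ℤ)) / ((p : ℤ) - 1) ≡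
              padicValRat p ((E.baseChange F).modifiedTamagawaProduct /
                (E.baseChange M).modifiedTamagawaProduct) [ZMOD 2]) :
    ∀ (p : ℕ) [Fact p.Prime], p ≠ 2 →
      ∀ (R : Type) [Field R] [NumberField R] (F : Type) [Field F] [NumberField F] [Algebra R F]
        [IsGalois R F], Nonempty ((F ≃ₐ[R] F) ≃* DihedralGroup p) →
        ∀ (M : Type) [Field M] [NumberField M] [Algebra R M] [Algebra M F] [IsScalarTower R M F],
          Module.finrank R M = 2 →
          ∀ (E : WeierstrassCurve R) [E.IsElliptic] (mρ : ℕ),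
            (E.baseChange F).selmerCorank p = (E.baseChange M).selmerCorank p + (p - 1) * mρ →
              (((E.baseChange M).selmerCorank p + mρ : ℕ) : ℤ) ≡
                padicValRat p ((E.baseChange F).modifiedTamagawaProduct /
                  (E.baseChange M).modifiedTamagawaProduct) [ZMOD 2] := by
  intro p _ hp R _ _ F _ _ _ _ hiso M _ _ _ _ _ hM E _ mρ hmρ
  obtain ⟨e⟩ := hiso
  have hprime : p.Prime := Fact.out
  obtain ⟨m, hm⟩ := hprime.odd_of_ne_two hp
  haveI : FiniteDimensional R F := Module.Finite.of_restrictScalars_finite ℚ R F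
  have hRF : Module.finrank R F = 2 * p := by
    rw [← IsGalois.card_aut_eq_finrank, Nat.card_congr e.toEquiv, DihedralGroup.nat_card]
  -- `L = F^{⟨h₀⟩}` for the reflection `h₀ = e⁻¹(sr 0)`
  set h₀ : F ≃ₐ[R] F := e.symm (DihedralGroup.sr 0) with hh₀def
  set Lf : IntermediateField R F := fixedField (Subgroup.zpowers h₀) with hLfdef
  haveI : NumberField Lf := numberField_intermediateField Lf
  have hord : orderOf h₀ = 2 := by
    rw [hh₀def, MulEquiv.orderOf_eq]
    exact DihedralGroup.orderOf_sr 0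
  have hLfF : Module.finrank Lf F = 2 := by
    rw [hLfdef, finrank_fixedField_eq_card, Nat.card_zpowers, hord]
  have hL : Module.finrank R Lf = p := by
    have h := Module.finrank_mul_finrank R Lf F
    rw [hRF, hLfF, mul_comm _ 2] at h
    omega
  -- the bookkeeping of p. 26
  obtain ⟨k, hkF, hkL⟩ := exists_selmerCorank_baseChange_dihedral_eq E F p hp e M hM Lf hL
  have hk : k = mρ := by
    have h1 : (p - 1) * k = (p - 1) * mρ := Nat.add_left_cancel (hkF.symm.trans hmρ)
    exact Nat.eq_of_mul_eq_mul_left (by have := hprime.one_lt; omega) h1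
  have hpm : (p - 1) / 2 = m := by omega
  rw [hpm, hk] at hkL
  -- Prop. 4.17 for `R ⊆ M, L ⊆ F`
  have hcong := h417V p hp R F ⟨e⟩ M hM Lf hL E
  have hq : 2 * (((E.baseChange Lf).selmerCorank p : ℤ) - (E.selmerCorank p : ℤ)) / ((p : ℤ) - 1) =
      mρ := by
    have hp1 : (p : ℤ) - 1 = 2 * m := by rw [hm]; push_cast; ring
    have hm0 : (2 * m : ℤ) ≠ 0 := by
      have : 0 < m := by
        by_contra h0
        have : m = 0 := by omega
        rw [this] at hm
        exact hprime.one_lt.ne' (by omega)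
      positivity
    rw [hkL, hp1]
    push_cast
    rw [show (2 : ℤ) * ((E.selmerCorank p : ℤ) + (m : ℤ) * (mρ : ℤ) - (E.selmerCorank p : ℤ)) =
      2 * (m : ℤ) * (mρ : ℤ) by ring]
    exact Int.mul_ediv_cancel_left _ hm0
  rw [hq] at hcong
  push_cast
  exact hcong

/-- **The named fact `dokchitser_selmerCorank_baseChange_mod_two_eq` from Prop. 4.17 verbatim and
the Cornut–Vatsal / Nekovář input** (Dokchitser–Dokchitser 2010, §4.6, step (4) of the proof of
Thm. 4.19 = Thm. 1.4: `rk_p(E/M₀)` is odd). Hypotheses: `h417V` — Prop. 4.17 of the source for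
elliptic curves, as printed (see `prop417_p27_of_prop417_verbatim`); `hCV` — "Now take `n` large
enough. Then Cornut–Vatsal's Thm. 1.5 [with Yuan–Zhang–Zhang and Tian–Zhang, or Cornut–Vatsal
Thm. 4.2 with Nekovář Thm. 3.2] … so `m_ρ = pⁿ`", i.e. `rk_p(E/M_{n+1}) = rk_p(E/M_n) + (p-1) pⁿ`
for all large `n` (`(p-1) m_ρ = rk_p(E/M_{n+1}) - rk_p(E/M_n)` by Lemma 4.14,
`exists_selmerCorank_baseChange_eq_add_of_prime_degree`). Every other sentence of the printed proof
of step (4) is a theorem of the tree (the anticyclotomic tower, Cor. 4.15, Lemma 4.14 and the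
`D_{2p}` bookkeeping of p. 26, `Gal(M_{n+1}/K_n) ≅ D_{2p}`, the squares remark of p. 27); the
assembly is `dokchitser_selmerCorank_baseChange_mod_two_eq_of_prop417_dihedral_of_hCV`. What remains
hypothetical: Prop. 4.17 itself (§§4.1–4.3: Thm. 4.3, Cor. 4.5 with the Cassels–Tate pairing,
Thm. 4.7, for products of Weil restrictions) and the CM-point theorem of Cornut–Vatsal with
Tian–Zhang / Nekovář.
[cite: DokchitserDokchitserAnnals2010, Prop. 4.17 (p. 25) and §4.6, proof of Thm. 4.19 (= Thm. 1.4), pp. 26–27]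
[cite: CornutVatsal2007, Thm. 1.5 and Thm. 4.2] [cite: Nekovar2007, Thm. 3.2] -/
theorem dokchitser_selmerCorank_baseChange_mod_two_eq_of_prop417_verbatim_of_hCV
    (h417V : ∀ (p : ℕ) [Fact p.Prime], p ≠ 2 →
      ∀ (R : Type) [Field R] [NumberField R] (F : Type) [Field F] [NumberField F] [Algebra R F]
        [IsGalois R F], Nonempty ((F ≃ₐ[R] F) ≃* DihedralGroup p) →
        ∀ (M : Type) [Field M] [NumberField M] [Algebra R M] [Algebra M F] [IsScalarTower R M F],
          Module.finrank R M = 2 →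
        ∀ (L : Type) [Field L] [NumberField L] [Algebra R L] [Algebra L F] [IsScalarTower R L F],
          Module.finrank R L = p →
          ∀ (E : WeierstrassCurve R) [E.IsElliptic],
            ((E.baseChange M).selmerCorank p : ℤ) +
                2 * (((E.baseChange L).selmerCorank p : ℤ) - (E.selmerCorank p : ℤ)) / ((p : ℤ) - 1) ≡
              padicValRat p ((E.baseChange F).modifiedTamagawaProduct /
                (E.baseChange M).modifiedTamagawaProduct) [ZMOD 2])
    (hCV : ∀ (W : WeierstrassCurve ℚ) [W.IsElliptic] (p : ℕ) [Fact p.Prime], p ≠ 2 →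
      ∀ (K : Type) [Field K] [NumberField K], IsImaginaryQuadratic K →
        SatisfiesHeegnerHypothesis (W.conductorNorm ℤ) K →
          ∀ (κ : ZpExtension K p), κ.IsAnticyclotomic → ∃ n₀ : ℕ, ∀ n ≥ n₀,
            (W.baseChange (κ.layer (n + 1))).selmerCorank p =
              (W.baseChange (κ.layer n)).selmerCorank p + (p - 1) * p ^ n) :
    dokchitser_selmerCorank_baseChange_mod_two_eq :=
  dokchitser_selmerCorank_baseChange_mod_two_eq_of_prop417_dihedral_of_hCV
    (prop417_p27_of_prop417_verbatim h417V) hCV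

end Verbatim

end Literature.NumberTheory.EllipticCurves
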